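import Literature.MathematicalPhysics.QuantumFieldTheory.Balaban1983to89.B9Eq371CoCurlLeibnizY
import Literature.MathematicalPhysics.QuantumFieldTheory.Balaban1983to89.B9Eq3104CommutatorSizesCurv
import Literature.MathematicalPhysics.QuantumFieldTheory.Balaban1983to89.Node00.OpsYEq3117Identity
import Literature.MathematicalPhysics.QuantumFieldTheory.Balaban1983to89.B11Eq135Weitzenbock

/-!
# `Balaban1983to89.B9Ineq373HessianPieceBoundsY` — [B9] (3.73) p. 405 AT def-Y'S LETTERS: the sizes of the Laplacian piece `Δ(1) − Δ(V) = V⁰ + Σ_μ V¹_μ∘∇_μ` (parts I∕II)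
# from the three small-field WINDOWS on `V` in the distance-2 block neighbourhood — `‖(V¹_μY)(b)‖ ≤ |c_f|(4ω₁ + 8(d+1)(ω₃+2ω₁))·sup|Y|`,
# `‖(V⁰X)(b)‖ ≤ c_f²(d+1)(4ω₂ + 16(ω₃+2ω₁)ω₁ + 16ω₃)·sup|X|` — and, REALIFIED over r05's cube geometry, ★★★ `hasMajorant_V0Y` ∕ `hasMajorant_V1Y` = the `hV0` ∕ `hV1 ν`
# inputs of G-F5's `cor35_G_cube_of_pieces` (sub-row G-B9-LETTERS, module M5.1b-G, FILE G-F5a part III = the estimates)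

T. Bałaban, *Propagators for lattice gauge theories in a background field*, Commun. Math. Phys. **99** (1985) 389–434
[`Balaban1985BackgroundPropagators`, "B9"]; [4] = Commun. Math. Phys. **96** (1984) 223–250 [`Balaban1984PropagatorsII`].

statement-level skeleton of published theorems with citation tags; proofs where landed; nothing here is a claim about the
Yang–Mills mass gap

THE PRINTED LOCUS (verbatim, held `paper:balaban1985-cmp99-background-propagators` p0016–p0017 = pp. 404–405).  p. 404: *«|(Δ′(U′U)A′)(b)| ≦ O(1)(Mα₀ + α₁)(Lʲη)⁻²|A′|,
b ∈ Ω_j (3.69) the supremum on the right-hand side is taken over bonds belonging to one of the plaquettes containing the bond b … the estimates follow directly from the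
assumptions (3.35), (3.37).»*; p. 405: *«The operator V₁ satisfies |(V₁(A)A′)(b)| ≦ O(1)(|∇A||A′| + |A|²|A′|) + O(1)|A|(|∇_UA′| + …) ≦ O(1)α₁((Lʲη)⁻¹|∇_UA′| +
(Lʲη)⁻²|A′|), b ∈ Ω_j, (3.73) with the same conditions on norms as above. The derivatives are, of course, the covariant derivatives defined by U. The constant O(1) is
an absolute constant depending on d only.»*  Here `U = 1` (Cor. 3.6's cube road) and `M α₀` does not occur (no background `U`).

WHY THIS FILE (cell `lit-balaban`, sub-row G-B9-LETTERS; module M5.1b-G after parts I `B9Eq371HessianSplitY` p646838 ✓, II `B9Eq371CoCurlLeibnizY` p648023, the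
assembly `B9Cor35GAtCubeLetters` p645320 ✓).  Part II discharged the assembly's `hLap` with explicit letters `V0Y`, `V1Y`; THIS FILE proves their (3.73)-sizes.  In
print's notation the three WINDOWS are the (3.37) readings of `U′ = e^{iηA}`: `ω₁ ~ η|A| ≤ α₁η∕(Lʲη)` (bond variable minus one), `ω₂ ~ η²|∇A| ≤ α₁η²∕(Lʲη)²`
(nearest-neighbour VARIATION of a bond variable), `ω₃ ~ ‖U′(∂p) − 1‖ ≤ α₁η²∕(Lʲη)²` (plaquette); they are DISPLAYED here as hypotheses holding at every site ∕
plaquette whose block is within block-graph distance `2` of the output block `a` («the norms determined by the set st(b)»), with `len(a) = Lⁿη` for the scale —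
the smallness bridge from the (3.35) datum supplies them (a separate file).  §1–§3 bound the constituent letters pointwise (`R(u)w − w`, `R(u)w − R(u′)w` for
bi-contractive `u`; `B¹⁰_V`, `W_{V,μ}`, `K_V`, `sel_μ`; the co-curl∕Jordan difference `D*_V𝒦_V − D*₁` over the `≤ 4(d+1)` plaquettes through a bond; the curvature
commutator `Δ′₂(V)`), §4 does the block-graph bookkeeping of the stencil (every site read lies within distance `2`), §5 assembles ★★★ `norm_V1Y_apply_le`,
`norm_V0Y_apply_le`, §6 realifies through n06-c's READING ⇒ MAJORANT device (`hasMajorant_conj_of_liftY_bound`): a product-form input supported in a block at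
distance `> 2` is not read at all, one at distance `≤ 2` costs `e^{2δ}·e^{−δd}`.

WHAT THIS FILE PROVES (THEOREMS + the real constants `cV1 d = 4 + 24(d+1)`, `cV0 d = 68(d+1)` and the `abbrev dSite`; 0 `def … : Prop`, 0 sorry).
§1 `norm_R_sub_R_le`, `norm_Rinv_sub_self_le` (`‖R(u)w − w‖` is `B11Eq135Weitzenbock.norm_R_sub_self_le`); §2 `norm_B10Y_apply_le`, `norm_WY_apply_le`, `norm_KY_apply_le`, `norm_selY_apply_le`; §3 `edgeParY_cases`,
`norm_jordanY_sub_le` (`‖𝒦_VF(p) − F(p)‖ ≤ ‖Re U(∂p) − 1‖‖F(p)‖`), ★ `norm_coCurlJordan_sub_apply_le` (`≤ |c_f|·4(d+1)(ω₃ + 2ω₁)·s`), ★ `norm_curv2Y_apply_le`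
(`≤ c_f²·16(d+1)ω₃·s`); §4 `dSite`, `dSite_shift_le`, `dSite_self`, `plaq_src_of_edgeY`, `dSite_plaq_src_le`, `dSite_edge_src_le`; §5 ★★★ `norm_V1Y_apply_le`, ★★★ `norm_V0Y_apply_le`;
§6 `blkV1_cubeFamY_eq`, `abs_cf_eq` (`|c_f| = η⁻¹`), ★★★ `hasMajorant_V1Y`
(`conj b(V1Y ν^ℝ) ≺ (M₂Σ‖b_j‖)·cV1(d)e^{2δ}·α₁·len(a)⁻¹·e^{−δd}`), ★★★ `hasMajorant_V0Y` (`conj b(V0Y^ℝ) ≺ (M₂Σ‖b_j‖)·cV0(d)e^{2δ}·α₁·(len(a)²)⁻¹·e^{−δd}`, `α₁ ≤ 1`).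

HONEST SCOPE.  Finite-stencil norm bookkeeping over landed letters (parts I∕II, def-Y, p38's `B9Eq3104CommutatorSizesCurv`, r05's cube geometry `geoCK` with p33's
`stencil_geoCK`, n06-c's realification); the WINDOWS are hypotheses (not derived here from (3.35)∕(3.37)), bi-contractivity of `V` is a hypothesis; no propagator, no
random walk.  After this file the Laplacian side of the bond-sector Cor. 3.5 for the cube letter (`cor35_G_cube_of_pieces`'s `hLap`, `hV0`, `hV1`) rests only on the
smallness bridge (windows from the (3.35) datum) and constant reshaping.  Count-neutral; NOT a node discharge; no summit ∕ sub-problem statement is proved; nothing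
continuum ∕ OS ∕ mass-gap ∕ Clay; YM mass gap NOT proved by any of this (Track A conditional rung).  No `sorry`, no `axiom`, no `… : Prop` fact, no `instance`, no
`notation`.  NEW file; nothing landed is modified.  Cell `lit-balaban`, seat `lit-balaban-p38` gen 42, 2026-08-28; `--supports stmt-QuantumFields-19200`.
Net new unproved facts: 0.

RELATED IN THE TREE, NOT DUPLICATED: r06's (3.72)∕(3.73) with explicit constants at the torus letters (`B9Eq371Composition`, `B9Eq372Operator`); cell pub-balaban t4's
pointwise principal-part bound `B9Eq371BondPrincipalTwoBackgroundSplit.norm_covLapPrincipal_sub_flat_apply_le` (abstract transporters, no `𝒦`, no `Δ′`); G-F5c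
`B9Cor35GCubeAvgPiece.hasMajorant_avgPieceK` (the averaging piece by the same realification device).
-/

noncomputable section

namespace Literature.MathematicalPhysics.QuantumFieldTheory.Balaban1983to89.B9Ineq373HessianPieceBoundsY

open Node00
open Literature.MathematicalPhysics.QuantumFieldTheory.Balaban1983to89
open Literature.MathematicalPhysics.QuantumFieldTheory.Balaban1983to89.B6KLevelCensusIndexV1 (KIdx)
open Literature.MathematicalPhysics.QuantumFieldTheory.Balaban1983to89.B6GlobalChartV1 (PV)
open Literature.MathematicalPhysics.QuantumFieldTheory.Balaban1983to89.B9Eq39Adjoint (R R_add R_sub R_smul)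
open Literature.MathematicalPhysics.QuantumFieldTheory.Balaban1983to89.B9Eq310Hermitian (norm_R_le)
open Literature.MathematicalPhysics.QuantumFieldTheory.Balaban1983to89.B9Ineq369CurvatureSmallAtLettersY (norm_sgnY)
open Literature.MathematicalPhysics.QuantumFieldTheory.Balaban1983to89.B13OpsYPencilHessian (norm_commY_le)
open Literature.MathematicalPhysics.QuantumFieldTheory.Balaban1983to89.B9Eq3104CommutatorSizesCurv (curv2Y_apply norm_primeEdgeY_le sum_edge_indicator_le)
open Literature.MathematicalPhysics.QuantumFieldTheory.Balaban1983to89.Node00.OpsYEq3117Identity (coCurlY_apply_eq_sum_edgeY)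
open Literature.MathematicalPhysics.QuantumFieldTheory.Balaban1983to89.Node00.OpsYNablaBridge (chartY shiftY_chartY shiftY_symm_chartY unshift_shift shift_unshift)
open Literature.MathematicalPhysics.QuantumFieldTheory.Balaban1983to89.B6Cover236MultiLevelBlocks (cubes)
open Literature.MathematicalPhysics.QuantumFieldTheory.Balaban1983to89.B9CubeLettersOpsL0 (cubeFamY)
open Literature.MathematicalPhysics.QuantumFieldTheory.Balaban1983to89.B9CubeLettersBondOpsL0 (BlkCubeY)
open Literature.MathematicalPhysics.QuantumFieldTheory.Balaban1983to89.B9Eq360DeltaPrimeACubeY (blkCubeY)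
open Literature.MathematicalPhysics.QuantumFieldTheory.Balaban1983to89.B9CubeGeometryInputs (geoCK geoCK_dist_axioms stencil_geoCK geoCK_len geoCK_eta geoCK_eta_pos geoCK_len_pos)
open Literature.MathematicalPhysics.QuantumFieldTheory.Balaban1983to89.B6KLevelCensusIndexV1 (kGeo)
open Literature.MathematicalPhysics.QuantumFieldTheory.Balaban1983to89.B6GlobalChartV1L0 (blkV1)
open Literature.MathematicalPhysics.QuantumFieldTheory.Balaban1983to89.B9Cor35GCubeInputsAtOne (blkBK kGeo_eta)
open Literature.MathematicalPhysics.QuantumFieldTheory.Balaban1983to89.B6RandomWalk (HasMajorant)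
open Literature.MathematicalPhysics.QuantumFieldTheory.Balaban1983to89.B9Thm34Ext (toB6)
open Literature.MathematicalPhysics.QuantumFieldTheory.Balaban1983to89.B9Eq371HessianSplitY (nablaY nablaY_apply KY KY_apply selY selY_apply)
open Literature.MathematicalPhysics.QuantumFieldTheory.Balaban1983to89.B9Eq371CoCurlLeibnizY (B10Y B10Y_apply WY WY_apply V0Y V1Y unshift_shift_comm)

variable {d ℓ : ℕ} {hd : 1 ≤ d + 1} {hL : Odd (ℓ + 1) ∧ 1 < ℓ + 1} {b₀ b₁ : ℝ}
variable {𝔸 : Type} [NormedRing 𝔸] [NormedAlgebra ℂ 𝔸] [CompleteSpace 𝔸]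
variable (i : KIdx d ℓ hd hL b₀ b₁)

/-! ## §1  The transporter windows as coefficient bounds: `‖R(u)w − R(u′)w‖ ≤ 2‖u − u′‖‖w‖`, `‖R(u⁻¹)w − w‖ ≤ 2‖u − 1‖‖w‖` for bi-contractive `u, u′` (`‖R(u)w − w‖`: B11's) -/

omit [NormedAlgebra ℂ 𝔸] [CompleteSpace 𝔸] in
/-- `‖R(u)w − R(u′)w‖ ≤ 2‖u − u′‖·‖w‖` for bi-contractive `u, u′` — the transporter VARIATION (print's `|∇A|`). [cite: Balaban1985BackgroundPropagators, (3.71) p.404, (3.73) p.405] -/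
theorem norm_R_sub_R_le {u u' : 𝔸ˣ} (hu : ‖(u : 𝔸)‖ ≤ 1 ∧ ‖((u⁻¹ : 𝔸ˣ) : 𝔸)‖ ≤ 1) (hu' : ‖(u' : 𝔸)‖ ≤ 1 ∧ ‖((u'⁻¹ : 𝔸ˣ) : 𝔸)‖ ≤ 1) (w : 𝔸) :
    ‖R u w - R u' w‖ ≤ 2 * ‖(u : 𝔸) - u'‖ * ‖w‖ := by
  have e : R u w - R u' w = ((u : 𝔸) - u') * w * ((u⁻¹ : 𝔸ˣ) : 𝔸) + (u' : 𝔸) * w * (((u⁻¹ : 𝔸ˣ) : 𝔸) * ((u' : 𝔸) - u) * ((u'⁻¹ : 𝔸ˣ) : 𝔸)) := by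
    have h1 : ((u⁻¹ : 𝔸ˣ) : 𝔸) * ((u' : 𝔸) - u) * ((u'⁻¹ : 𝔸ˣ) : 𝔸) = ((u⁻¹ : 𝔸ˣ) : 𝔸) - ((u'⁻¹ : 𝔸ˣ) : 𝔸) := by
      rw [mul_sub, sub_mul, mul_assoc, Units.mul_inv, mul_one, Units.inv_mul, one_mul]
    rw [h1]; unfold R; noncomm_ring
  rw [e]
  refine (norm_add_le _ _).trans ?_
  have t1 : ‖((u : 𝔸) - u') * w * ((u⁻¹ : 𝔸ˣ) : 𝔸)‖ ≤ ‖(u : 𝔸) - u'‖ * ‖w‖ := by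
    refine (norm_mul_le _ _).trans ?_
    calc ‖((u : 𝔸) - u') * w‖ * ‖((u⁻¹ : 𝔸ˣ) : 𝔸)‖ ≤ ‖((u : 𝔸) - u') * w‖ * 1 := by gcongr; exact hu.2
      _ ≤ ‖(u : 𝔸) - u'‖ * ‖w‖ := by rw [mul_one]; exact norm_mul_le _ _
  have t2 : ‖(u' : 𝔸) * w * (((u⁻¹ : 𝔸ˣ) : 𝔸) * ((u' : 𝔸) - u) * ((u'⁻¹ : 𝔸ˣ) : 𝔸))‖ ≤ ‖(u : 𝔸) - u'‖ * ‖w‖ := by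
    have h3 : ‖((u⁻¹ : 𝔸ˣ) : 𝔸) * ((u' : 𝔸) - u) * ((u'⁻¹ : 𝔸ˣ) : 𝔸)‖ ≤ ‖(u : 𝔸) - u'‖ := by
      calc ‖((u⁻¹ : 𝔸ˣ) : 𝔸) * ((u' : 𝔸) - u) * ((u'⁻¹ : 𝔸ˣ) : 𝔸)‖
          ≤ ‖((u⁻¹ : 𝔸ˣ) : 𝔸)‖ * ‖(u' : 𝔸) - u‖ * ‖((u'⁻¹ : 𝔸ˣ) : 𝔸)‖ := by
            refine (norm_mul_le _ _).trans ?_; gcongr; exact norm_mul_le _ _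
        _ ≤ 1 * ‖(u' : 𝔸) - u‖ * 1 := by gcongr; exacts [hu.2, hu'.2]
        _ = ‖(u : 𝔸) - u'‖ := by rw [one_mul, mul_one, norm_sub_rev]
    calc ‖(u' : 𝔸) * w * (((u⁻¹ : 𝔸ˣ) : 𝔸) * ((u' : 𝔸) - u) * ((u'⁻¹ : 𝔸ˣ) : 𝔸))‖
        ≤ ‖(u' : 𝔸)‖ * ‖w‖ * ‖((u⁻¹ : 𝔸ˣ) : 𝔸) * ((u' : 𝔸) - u) * ((u'⁻¹ : 𝔸ˣ) : 𝔸)‖ := by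
          refine (norm_mul_le _ _).trans ?_; gcongr; exact norm_mul_le _ _
      _ ≤ 1 * ‖w‖ * ‖(u : 𝔸) - u'‖ := by gcongr; exact hu'.1
      _ = ‖(u : 𝔸) - u'‖ * ‖w‖ := by ring
  linarith

/-! ## §2  Pointwise stencil bounds of the letters `B¹⁰_V`, `W_{V,μ}`, `K_V`, `sel_μ` -/

section Letters

variable {V : CfgY 𝔸 i} (hU : ∀ μ x, ‖(V μ x : 𝔸)‖ ≤ 1 ∧ ‖(((V μ x)⁻¹ : 𝔸ˣ) : 𝔸)‖ ≤ 1)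
include hU

/-- ★ **`B¹⁰_V` at a bond `b = ⟨x, κ⟩`**: with the VARIATION window `‖V_a(x) − V_a(x − e_μ)‖ ≤ ω₂` at `x` (all `a, μ`) and `‖X‖ ≤ s` on the shifted edges `⟨x+e_μ, κ⟩`, `⟨x+e_κ, μ⟩`:
`‖(B¹⁰_VX)(b)‖ ≤ c_f²·(d+1)·4ω₂·s`. [cite: Balaban1985BackgroundPropagators, (3.71) p.404, (3.73) p.405 (the `|∇A||A′|` term)] -/
theorem norm_B10Y_apply_le (b : FBondY i) {ω₂ s : ℝ} (hs : 0 ≤ s)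
    (hW2 : ∀ a μ : Fin (d + 1), ‖(V a b.src : 𝔸) - V a (b.src.unshift μ)‖ ≤ ω₂)
    (X : FBondY i → 𝔸) (hX : ∀ μ : Fin (d + 1), ‖X ⟨b.src.shift μ, b.dir⟩‖ ≤ s ∧ ‖X ⟨b.src.shift b.dir, μ⟩‖ ≤ s) :
    ‖B10Y i V X b‖ ≤ i.cf ^ 2 * (((d : ℝ) + 1) * (4 * ω₂ * s)) := by
  rw [B10Y_apply, norm_smul, ← Complex.ofReal_mul, Complex.norm_real, Real.norm_eq_abs, ← sq, abs_of_nonneg (sq_nonneg _)]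
  refine mul_le_mul_of_nonneg_left ?_ (sq_nonneg _)
  calc ‖∑ μ : Fin (d + 1), _‖ ≤ ∑ μ : Fin (d + 1), (4 * ω₂ * s) := norm_sum_le_of_le _ fun μ _ => ?_
    _ = ((d : ℝ) + 1) * (4 * ω₂ * s) := by rw [Finset.sum_const, Finset.card_univ, Fintype.card_fin, nsmul_eq_mul]; push_cast; ring
  split_ifs with h
  · rw [norm_zero]
    have hω : 0 ≤ ω₂ := (norm_nonneg _).trans (hW2 0 0)
    exact mul_nonneg (mul_nonneg (by norm_num) hω) hs
  · refine (norm_sub_le _ _).trans ?_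
    have t1 := norm_R_sub_R_le (hU μ b.src) (hU μ (b.src.unshift μ)) (X ⟨b.src.shift μ, b.dir⟩)
    have t2 := norm_R_sub_R_le (hU b.dir b.src) (hU b.dir (b.src.unshift μ)) (X ⟨b.src.shift b.dir, μ⟩)
    have w1 := hW2 μ μ
    have w2 := hW2 b.dir μ
    have x1 := (hX μ).1
    have x2 := (hX μ).2
    have hω : 0 ≤ ω₂ := (norm_nonneg _).trans w1
    nlinarith [norm_nonneg ((V μ b.src : 𝔸) - V μ (b.src.unshift μ)), norm_nonneg ((V b.dir b.src : 𝔸) - V b.dir (b.src.unshift μ)),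
      norm_nonneg (X ⟨b.src.shift μ, b.dir⟩), norm_nonneg (X ⟨b.src.shift b.dir, μ⟩), mul_nonneg hω hs]

/-- ★ **`W_{V,μ}` at a bond `b = ⟨x, κ⟩`**: with the window `‖V_a(x − e_μ) − 1‖ ≤ ω₁` (all `a`) and `‖Y‖ ≤ s` at `b` and at `⟨x+e_κ−e_μ, μ⟩`: `‖(W_{V,μ}Y)(b)‖ ≤ |c_f|·4ω₁·s`.
[cite: Balaban1985BackgroundPropagators, (3.71) p.404, (3.73) p.405 (the `|A||∇A′|` term)] -/
theorem norm_WY_apply_le (μ : Fin (d + 1)) (b : FBondY i) {ω₁ s : ℝ} (hs : 0 ≤ s)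
    (hW1 : ∀ a : Fin (d + 1), ‖(V a (b.src.unshift μ) : 𝔸) - 1‖ ≤ ω₁)
    (Y : FBondY i → 𝔸) (hY : ‖Y b‖ ≤ s ∧ ‖Y ⟨(b.src.shift b.dir).unshift μ, μ⟩‖ ≤ s) :
    ‖WY i V μ Y b‖ ≤ |i.cf| * (4 * ω₁ * s) := by
  rw [WY_apply]
  split_ifs with h
  · rw [norm_zero]
    have hω : 0 ≤ ω₁ := (norm_nonneg _).trans (hW1 0)
    exact mul_nonneg (abs_nonneg _) (mul_nonneg (mul_nonneg (by norm_num) hω) hs)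
  · rw [norm_smul, Complex.norm_real, Real.norm_eq_abs]
    refine mul_le_mul_of_nonneg_left ?_ (abs_nonneg _)
    refine (norm_sub_le _ _).trans ?_
    have t1 := B11Eq135Weitzenbock.norm_R_sub_self_le (hU μ (b.src.unshift μ)).2 (Y b)
    have t2 := B11Eq135Weitzenbock.norm_R_sub_self_le (hU b.dir (b.src.unshift μ)).2 (Y ⟨(b.src.shift b.dir).unshift μ, μ⟩)
    have w1 := hW1 μ
    have w2 := hW1 b.dir
    have hω : 0 ≤ ω₁ := (norm_nonneg _).trans w1
    nlinarith [norm_nonneg ((V μ (b.src.unshift μ) : 𝔸) - 1), norm_nonneg ((V b.dir (b.src.unshift μ) : 𝔸) - 1), norm_nonneg (Y b),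
      norm_nonneg (Y ⟨(b.src.shift b.dir).unshift μ, μ⟩), mul_nonneg hω hs, hY.1, hY.2]

/-- ★ **`K_V` at a plaquette `p = p_{μν}(y)`**: with `‖V_a(y) − 1‖ ≤ ω₁` and `‖X‖ ≤ s` on the shifted edges: `‖(K_VX)(p)‖ ≤ 4ω₁·s`.
[cite: Balaban1985BackgroundPropagators, (3.70) p.404] -/
theorem norm_KY_apply_le (p : PlaqY i) {ω₁ s : ℝ} (hs : 0 ≤ s) (hW1 : ∀ a : Fin (d + 1), ‖(V a p.src : 𝔸) - 1‖ ≤ ω₁)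
    (X : FBondY i → 𝔸) (hX : ‖X ⟨p.src.shift p.μ, p.ν⟩‖ ≤ s ∧ ‖X ⟨p.src.shift p.ν, p.μ⟩‖ ≤ s) :
    ‖KY i V X p‖ ≤ 4 * ω₁ * s := by
  rw [B9Eq371HessianSplitY.KY_apply]
  refine (norm_sub_le _ _).trans ?_
  have t1 := B11Eq135Weitzenbock.norm_R_sub_self_le (hU p.μ p.src).2 (X ⟨p.src.shift p.μ, p.ν⟩)
  have t2 := B11Eq135Weitzenbock.norm_R_sub_self_le (hU p.ν p.src).2 (X ⟨p.src.shift p.ν, p.μ⟩)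
  have w1 := hW1 p.μ
  have w2 := hW1 p.ν
  have hω : 0 ≤ ω₁ := (norm_nonneg _).trans w1
  nlinarith [norm_nonneg ((V p.μ p.src : 𝔸) - 1), norm_nonneg ((V p.ν p.src : 𝔸) - 1), norm_nonneg (X ⟨p.src.shift p.μ, p.ν⟩),
    norm_nonneg (X ⟨p.src.shift p.ν, p.μ⟩), mul_nonneg hω hs, hX.1, hX.2]

end Letters

omit [CompleteSpace 𝔸] in
/-- `sel_μ` at a plaquette: `‖(sel_μY)(p)‖ ≤ 2s` if `‖Y‖ ≤ s` on the base edges. [cite: Balaban1985BackgroundPropagators, (3.4) p.391, bookkeeping] -/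
theorem norm_selY_apply_le (μ : Fin (d + 1)) (p : PlaqY i) {s : ℝ} (Y : FBondY i → 𝔸) (hY : ‖Y ⟨p.src, p.ν⟩‖ ≤ s ∧ ‖Y ⟨p.src, p.μ⟩‖ ≤ s) :
    ‖selY i μ Y p‖ ≤ 2 * s := by
  rw [selY_apply]
  refine (norm_sub_le _ _).trans ?_
  have hs : 0 ≤ s := (norm_nonneg _).trans hY.1
  split_ifs
  · linarith [hY.1, hY.2]
  · rw [norm_zero]; linarith [hY.1]
  · rw [norm_zero]; linarith [hY.2]
  · rw [norm_zero]; linarith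


omit [NormedAlgebra ℂ 𝔸] [CompleteSpace 𝔸] in
/-- `‖R(u⁻¹)w − w‖ ≤ 2‖u − 1‖·‖w‖` for bi-contractive `u`. [cite: Balaban1985BackgroundPropagators, (3.74) p.405 (the `D*_{U′U} − D*_U` terms)] -/
theorem norm_Rinv_sub_self_le {u : 𝔸ˣ} (hu : ‖(u : 𝔸)‖ ≤ 1 ∧ ‖((u⁻¹ : 𝔸ˣ) : 𝔸)‖ ≤ 1) (w : 𝔸) : ‖R u⁻¹ w - w‖ ≤ 2 * ‖(u : 𝔸) - 1‖ * ‖w‖ := by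
  have h := B11Eq135Weitzenbock.norm_R_sub_self_le (W := u⁻¹) (by rw [inv_inv]; exact hu.1) w
  have h2 : ‖((u⁻¹ : 𝔸ˣ) : 𝔸) - 1‖ ≤ ‖(u : 𝔸) - 1‖ := by
    have e : ((u⁻¹ : 𝔸ˣ) : 𝔸) - 1 = ((u⁻¹ : 𝔸ˣ) : 𝔸) * (1 - (u : 𝔸)) := by rw [mul_sub, mul_one, Units.inv_mul]
    rw [e]
    calc ‖((u⁻¹ : 𝔸ˣ) : 𝔸) * (1 - (u : 𝔸))‖ ≤ ‖((u⁻¹ : 𝔸ˣ) : 𝔸)‖ * ‖1 - (u : 𝔸)‖ := norm_mul_le _ _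
      _ ≤ 1 * ‖1 - (u : 𝔸)‖ := by gcongr; exact hu.2
      _ = ‖(u : 𝔸) - 1‖ := by rw [one_mul, norm_sub_rev]
  calc ‖R u⁻¹ w - w‖ ≤ 2 * ‖((u⁻¹ : 𝔸ˣ) : 𝔸) - 1‖ * ‖w‖ := h
    _ ≤ 2 * ‖(u : 𝔸) - 1‖ * ‖w‖ := by gcongr

/-! ## §3  The co-curl∕Jordan difference `D*_V𝒦_V − D*₁` and the curvature commutator `Δ′₂(V)`, pointwise over the plaquettes through a bond -/

section Plaquettes

variable {V : CfgY 𝔸 i} (hU : ∀ μ x, ‖(V μ x : 𝔸)‖ ≤ 1 ∧ ‖(((V μ x)⁻¹ : 𝔸ˣ) : 𝔸)‖ ≤ 1)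
include hU

omit hU in
/-- the transporters of the primed contour variables: `1` or a single bond variable at `p.src`. [cite: Balaban1985BackgroundPropagators, (3.2) p.390] -/
theorem edgeParY_cases (p : PlaqY i) (m : Fin 4) : edgeParY i V p m = 1 ∨ edgeParY i V p m = V p.ν p.src ∨ edgeParY i V p m = V p.μ p.src := by
  fin_cases m
  · exact Or.inr (Or.inl rfl)
  · exact Or.inl rfl
  · exact Or.inl rfl
  · exact Or.inr (Or.inr rfl)

omit hU in
/-- the Jordan insertion minus the identity is controlled by the plaquette window: `‖(𝒦_VF)(p) − F(p)‖ ≤ ‖Re U(∂p) − 1‖·‖F(p)‖`.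
[cite: Balaban1985BackgroundPropagators, (3.7) p.392, (3.10) p.392] -/
theorem norm_jordanY_sub_le (F : PlaqY i → 𝔸) (p : PlaqY i) : ‖jordanY i V F p - F p‖ ≤ ‖reHolY i V p - 1‖ * ‖F p‖ := by
  rw [jordanY_apply]
  have e : (1 / 2 : ℂ) • (F p * reHolY i V p + reHolY i V p * F p) - F p =
      (1 / 2 : ℂ) • (F p * (reHolY i V p - 1) + (reHolY i V p - 1) * F p) := by
    rw [mul_sub, sub_mul, mul_one, one_mul]
    module
  rw [e, norm_smul]
  have hn : ‖(1 / 2 : ℂ)‖ = 1 / 2 := by simp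
  rw [hn]
  have t := norm_add_le (F p * (reHolY i V p - 1)) ((reHolY i V p - 1) * F p)
  have t1 := norm_mul_le (F p) (reHolY i V p - 1)
  have t2 := norm_mul_le (reHolY i V p - 1) (F p)
  nlinarith [norm_nonneg (F p), norm_nonneg (reHolY i V p - 1)]

/-- ★ **THE CO-CURL∕JORDAN DIFFERENCE `(D*_V𝒦_V − D*₁)F` AT A BOND**: with the bond window `ω₁` at the sources of the plaquettes through `b`, the plaquette window
`‖Re U(∂p) − 1‖ ≤ ω₃` there and `‖F(p)‖ ≤ s` there: `‖(D*_V𝒦_VF − D*₁F)(b)‖ ≤ |c_f|·4(d+1)·(ω₃ + 2ω₁)·s`.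
[cite: Balaban1985BackgroundPropagators, (3.71) p.404, (3.74)–(3.75) p.405, (3.9)–(3.10) p.392] -/
theorem norm_coCurlJordan_sub_apply_le (b : FBondY i) {ω₁ ω₃ s : ℝ} (hs : 0 ≤ s) (hω₁ : 0 ≤ ω₁) (hω₃ : 0 ≤ ω₃)
    (hW1 : ∀ (p : PlaqY i) (m : Fin 4), edgeY i p m = b → ∀ a : Fin (d + 1), ‖(V a p.src : 𝔸) - 1‖ ≤ ω₁)
    (hW3 : ∀ (p : PlaqY i) (m : Fin 4), edgeY i p m = b → ‖reHolY i V p - 1‖ ≤ ω₃)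
    (F : PlaqY i → 𝔸) (hF : ∀ (p : PlaqY i) (m : Fin 4), edgeY i p m = b → ‖F p‖ ≤ s) :
    ‖((coCurlY i V ∘ₗ jordanY i V - coCurlY i (fun _ _ => (1 : 𝔸ˣ))) : (PlaqY i → 𝔸) →ₗ[ℂ] (FBondY i → 𝔸)) F b‖ ≤
      |i.cf| * (4 * ((d : ℝ) + 1) * ((ω₃ + 2 * ω₁) * s)) := by
  classical
  rw [LinearMap.sub_apply, LinearMap.comp_apply, Pi.sub_apply, coCurlY_apply_eq_sum_edgeY, coCurlY_apply_eq_sum_edgeY, ← smul_sub,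
    ← Finset.sum_sub_distrib, norm_smul, Complex.norm_real, Real.norm_eq_abs]
  refine mul_le_mul_of_nonneg_left ?_ (abs_nonneg _)
  have key : ∀ (p : PlaqY i), ‖(∑ m : Fin 4, (if edgeY i p m = b then sgnY m • R (edgeParY i V p m)⁻¹ (jordanY i V F p) else 0)) -
      ∑ m : Fin 4, (if edgeY i p m = b then sgnY m • R (edgeParY i (fun _ _ => (1 : 𝔸ˣ)) p m)⁻¹ (F p) else 0)‖ ≤
      ∑ m : Fin 4, (if edgeY i p m = b then (1 : ℝ) else 0) * ((ω₃ + 2 * ω₁) * s) := by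
    intro p
    rw [← Finset.sum_sub_distrib]
    refine norm_sum_le_of_le _ fun m _ => ?_
    split_ifs with h
    · rw [one_mul, ← smul_sub, norm_smul, norm_sgnY, one_mul]
      have e1 : edgeParY i (fun _ _ => (1 : 𝔸ˣ)) p m = 1 := by fin_cases m <;> rfl
      rw [e1, inv_one, B9Eq39Adjoint.R_one]
      have eq : R (edgeParY i V p m)⁻¹ (jordanY i V F p) - F p =
          R (edgeParY i V p m)⁻¹ (jordanY i V F p - F p) + (R (edgeParY i V p m)⁻¹ (F p) - F p) := by rw [R_sub]; abel
      rw [eq]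
      refine (norm_add_le _ _).trans ?_
      have hpar := hU
      have t1 : ‖R (edgeParY i V p m)⁻¹ (jordanY i V F p - F p)‖ ≤ ω₃ * s := by
        refine ((B9Eq3104CommutatorSizesCurv.norm_R_edgeParY_le i V hU p m _).2).trans ?_
        refine (norm_jordanY_sub_le i F p).trans ?_
        exact mul_le_mul (hW3 p m h) (hF p m h) (norm_nonneg _) hω₃
      have t2 : ‖R (edgeParY i V p m)⁻¹ (F p) - F p‖ ≤ 2 * ω₁ * s := by
        have hgen : ∀ u : 𝔸ˣ, (‖(u : 𝔸)‖ ≤ 1 ∧ ‖((u⁻¹ : 𝔸ˣ) : 𝔸)‖ ≤ 1) → ‖(u : 𝔸) - 1‖ ≤ ω₁ → ‖R u⁻¹ (F p) - F p‖ ≤ 2 * ω₁ * s := by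
          intro u hu hw
          refine (norm_Rinv_sub_self_le hu (F p)).trans ?_
          have := hF p m h
          nlinarith [norm_nonneg ((u : 𝔸) - 1), norm_nonneg (F p)]
        rcases edgeParY_cases i (V := V) p m with hm | hm | hm
        · rw [hm, inv_one, B9Eq39Adjoint.R_one, sub_self, norm_zero]; positivity
        · rw [hm]; exact hgen _ (hU _ _) (hW1 p m h p.ν)
        · rw [hm]; exact hgen _ (hU _ _) (hW1 p m h p.μ)
      linarith
    · rw [sub_self, norm_zero, zero_mul]
  calc ‖∑ p : PlaqY i, _‖ ≤ ∑ p : PlaqY i, ∑ m : Fin 4, (if edgeY i p m = b then (1 : ℝ) else 0) * ((ω₃ + 2 * ω₁) * s) :=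
        norm_sum_le_of_le _ fun p _ => key p
    _ = (∑ p : PlaqY i, ∑ m : Fin 4, (if edgeY i p m = b then (1 : ℝ) else 0)) * ((ω₃ + 2 * ω₁) * s) := by
        rw [Finset.sum_mul]; refine Finset.sum_congr rfl fun p _ => ?_; rw [Finset.sum_mul]
    _ ≤ 4 * ((d : ℝ) + 1) * ((ω₃ + 2 * ω₁) * s) := by
        refine mul_le_mul_of_nonneg_right (sum_edge_indicator_le i b) ?_; positivity

/-- ★ **THE CURVATURE COMMUTATOR `Δ′₂(V)` AT A BOND**: with `‖Im U(∂p)‖ ≤ ω₃` on the plaquettes through `b` and `‖X‖ ≤ s` on their edges: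
`‖(Δ′₂(V)X)(b)‖ ≤ c_f²·16(d+1)·ω₃·s`. [cite: Balaban1985BackgroundPropagators, (3.10) p.392, (3.69) p.404] -/
theorem norm_curv2Y_apply_le (b : FBondY i) {ω₃ s : ℝ} (hs : 0 ≤ s) (hω₃ : 0 ≤ ω₃)
    (hW3 : ∀ (p : PlaqY i) (m : Fin 4), edgeY i p m = b → ‖imHolY i V p‖ ≤ ω₃)
    (X : FBondY i → 𝔸) (hX : ∀ (p : PlaqY i) (m : Fin 4), edgeY i p m = b → ∀ l : Fin 4, ‖X (edgeY i p l)‖ ≤ s) :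
    ‖curv2Y i V X b‖ ≤ i.cf ^ 2 * (16 * ((d : ℝ) + 1) * (ω₃ * s)) := by
  classical
  rw [curv2Y_apply, norm_smul]
  have hn : ‖(1 / 2 : ℂ)‖ = 1 / 2 := by simp
  rw [hn]
  have key : ∀ (p : PlaqY i) (m : Fin 4), ‖(if edgeY i p m = b then
      sgnY m • R (edgeParY i V p m)⁻¹ (commY (((i.cf ^ 2 : ℝ) : ℂ) • imHolY i V p)
        ((∑ l : Fin 4, (if m < l then primeEdgeY i V p l else 0)) X - (∑ l : Fin 4, (if l < m then primeEdgeY i V p l else 0)) X))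
      else 0)‖ ≤ (if edgeY i p m = b then (1 : ℝ) else 0) * (i.cf ^ 2 * (8 * (ω₃ * s))) := by
    intro p m
    split_ifs with h
    · rw [one_mul, norm_smul, norm_sgnY, one_mul]
      refine ((B9Eq3104CommutatorSizesCurv.norm_R_edgeParY_le i V hU p m _).2).trans ?_
      refine (norm_commY_le _ _).trans ?_
      have hM : ‖(((i.cf ^ 2 : ℝ) : ℂ)) • imHolY i V p‖ ≤ i.cf ^ 2 * ω₃ := by
        rw [norm_smul, Complex.norm_real, Real.norm_eq_abs, abs_of_nonneg (sq_nonneg _)]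
        exact mul_le_mul_of_nonneg_left (hW3 p m h) (sq_nonneg _)
      have hS : ‖(∑ l : Fin 4, (if m < l then primeEdgeY i V p l else 0)) X - (∑ l : Fin 4, (if l < m then primeEdgeY i V p l else 0)) X‖ ≤ 4 * s := by
        rw [LinearMap.coe_sum, LinearMap.coe_sum, Finset.sum_apply, Finset.sum_apply]
        refine (norm_sub_le _ _).trans ?_
        have b1 : ∀ (P : Fin 4 → Prop) [DecidablePred P], ‖∑ l : Fin 4, (if P l then primeEdgeY i V p l else 0) X‖ ≤ ∑ l : Fin 4, (if P l then s else 0) := by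
          intro P _
          refine norm_sum_le_of_le _ fun l _ => ?_
          split_ifs with hl
          · exact (norm_primeEdgeY_le i V hU p l X).trans (hX p m h l)
          · rw [LinearMap.zero_apply, norm_zero]
        have c1 := b1 (fun l => m < l)
        have c2 := b1 (fun l => l < m)
        have d1 : (∑ l : Fin 4, (if m < l then s else 0)) + ∑ l : Fin 4, (if l < m then s else 0) ≤ 4 * s := by
          rw [← Finset.sum_add_distrib]
          calc ∑ l : Fin 4, ((if m < l then s else 0) + if l < m then s else 0) ≤ ∑ l : Fin 4, s :=
                Finset.sum_le_sum fun l _ => by split_ifs <;> first | linarith | exact absurd (lt_trans ‹_› ‹_›) (lt_irrefl _)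
            _ = 4 * s := by rw [Finset.sum_const, Finset.card_univ, Fintype.card_fin, nsmul_eq_mul]; push_cast; ring
        linarith
      calc 2 * ‖(((i.cf ^ 2 : ℝ) : ℂ)) • imHolY i V p‖ * ‖_‖ ≤ 2 * (i.cf ^ 2 * ω₃) * (4 * s) := by
            gcongr
        _ = i.cf ^ 2 * (8 * (ω₃ * s)) := by ring
    · rw [norm_zero, zero_mul]
  calc 1 / 2 * ‖∑ p : PlaqY i, ∑ m : Fin 4, _‖
      ≤ 1 / 2 * ∑ p : PlaqY i, ∑ m : Fin 4, (if edgeY i p m = b then (1 : ℝ) else 0) * (i.cf ^ 2 * (8 * (ω₃ * s))) := by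
        gcongr
        exact norm_sum_le_of_le _ fun p _ => norm_sum_le_of_le _ fun m _ => key p m
    _ = 1 / 2 * ((∑ p : PlaqY i, ∑ m : Fin 4, (if edgeY i p m = b then (1 : ℝ) else 0)) * (i.cf ^ 2 * (8 * (ω₃ * s)))) := by
        rw [Finset.sum_mul]; congr 1; refine Finset.sum_congr rfl fun p _ => ?_; rw [Finset.sum_mul]
    _ ≤ 1 / 2 * ((4 * ((d : ℝ) + 1)) * (i.cf ^ 2 * (8 * (ω₃ * s)))) := by
        gcongr; exact sum_edge_indicator_le i b
    _ = i.cf ^ 2 * (16 * ((d : ℝ) + 1) * (ω₃ * s)) := by ring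

end Plaquettes


/-! ## §4  Block-graph bookkeeping of the stencil: every site read by `V⁰`, `V¹_μ` at the bond `b = ⟨x, κ⟩` lies in a block at graph distance `≤ 2` from the block of `x` -/

section Geometry

variable (q : ↥(cubes (toKT i).D.toDomains))

/-- the block-graph distance from a block to the block of a torus site. [cite: Balaban1984PropagatorsII, (2.46) p.231, bookkeeping] -/
abbrev dSite (a : BlkCubeY i q) (y : Site (PV d ℓ i.m i.K hd hL) 0) : ℝ := (geoCK i q).dist a (blkCubeY i q (chartY i y))

/-- one lattice step moves the block by at most one edge of the block graph. [cite: Balaban1984PropagatorsII, (2.46) p.231; Balaban1985BackgroundPropagators, Thm 3.4 p.400 (stencil)] -/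
theorem dSite_shift_le (a : BlkCubeY i q) (y : Site (PV d ℓ i.m i.K hd hL) 0) (μ : Fin (d + 1)) :
    dSite i q a (y.shift μ) ≤ dSite i q a y + 1 ∧ dSite i q a (y.unshift μ) ≤ dSite i q a y + 1 := by
  obtain ⟨-, htri, -, -⟩ := geoCK_dist_axioms i q 0 True
  obtain ⟨hB, hF, -⟩ := stencil_geoCK i q
  have t1 := htri a (blkCubeY i q (chartY i y)) (blkCubeY i q (chartY i (y.shift μ)))
  have t2 := htri a (blkCubeY i q (chartY i y)) (blkCubeY i q (chartY i (y.unshift μ)))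
  change (geoCK i q).dist _ _ ≤ (geoCK i q).dist _ _ + (geoCK i q).dist _ _ at t1 t2
  have s1 := hF μ (chartY i y)
  have s2 := hB μ (chartY i y)
  rw [shiftY_chartY] at s1
  rw [shiftY_symm_chartY] at s2
  exact ⟨by unfold dSite; linarith, by unfold dSite; linarith⟩

/-- the block of a site is at distance `0` from itself. [cite: Balaban1984PropagatorsII, (2.46) p.231, bookkeeping] -/
theorem dSite_self (y : Site (PV d ℓ i.m i.K hd hL) 0) : dSite i q (blkCubeY i q (chartY i y)) y = 0 := by
  obtain ⟨-, -, hrefl, -⟩ := geoCK_dist_axioms i q 0 True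
  exact hrefl _

/-- a plaquette having `b` as an edge has its source at `b.src` or one step back from it. [cite: Balaban1985BackgroundPropagators, (3.2) p.390, bookkeeping] -/
theorem plaq_src_of_edgeY {p : PlaqY i} {m : Fin 4} {b : FBondY i} (h : edgeY i p m = b) :
    p.src = b.src ∨ p.src = b.src.unshift p.ν ∨ p.src = b.src.unshift p.μ := by
  fin_cases m
  · right; left
    have e : b.src = p.src.shift p.ν := by rw [← h]; rfl
    rw [e, unshift_shift]
  · left; have e : b.src = p.src := by rw [← h]; rfl
    exact e.symm
  · left; have e : b.src = p.src := by rw [← h]; rfl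
    exact e.symm
  · right; right
    have e : b.src = p.src.shift p.μ := by rw [← h]; rfl
    rw [e, unshift_shift]

/-- hence its source block is within distance `1` of the block of `b.src`. [cite: Balaban1984PropagatorsII, (2.46) p.231, bookkeeping] -/
theorem dSite_plaq_src_le {p : PlaqY i} {m : Fin 4} {b : FBondY i} (h : edgeY i p m = b) :
    dSite i q (blkCubeY i q (chartY i b.src)) p.src ≤ 1 := by
  have h0 := dSite_self i q b.src
  rcases plaq_src_of_edgeY i h with e | e | e
  · rw [e, h0]; norm_num
  · rw [e]; linarith [(dSite_shift_le i q (blkCubeY i q (chartY i b.src)) b.src p.ν).2]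
  · rw [e]; linarith [(dSite_shift_le i q (blkCubeY i q (chartY i b.src)) b.src p.μ).2]

/-- and every edge of such a plaquette has its source within distance `2`. [cite: Balaban1984PropagatorsII, (2.46) p.231, bookkeeping] -/
theorem dSite_edge_src_le {p : PlaqY i} {m : Fin 4} {b : FBondY i} (h : edgeY i p m = b) (l : Fin 4) :
    dSite i q (blkCubeY i q (chartY i b.src)) (edgeY i p l).src ≤ 2 := by
  have h1 := dSite_plaq_src_le i q h
  fin_cases l
  · show dSite i q _ (p.src.shift p.ν) ≤ 2
    linarith [(dSite_shift_le i q (blkCubeY i q (chartY i b.src)) p.src p.ν).1]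
  · show dSite i q _ p.src ≤ 2
    linarith
  · show dSite i q _ p.src ≤ 2
    linarith
  · show dSite i q _ (p.src.shift p.μ) ≤ 2
    linarith [(dSite_shift_le i q (blkCubeY i q (chartY i b.src)) p.src p.μ).1]

end Geometry

/-! ## §5  ★★★ The (3.73)-bounds of `V⁰`, `V¹_μ` at a bond, from the three windows in the distance-2 block neighbourhood -/

section Assembly

variable (q : ↥(cubes (toKT i).D.toDomains))
variable {V : CfgY 𝔸 i} (hU : ∀ μ x, ‖(V μ x : 𝔸)‖ ≤ 1 ∧ ‖(((V μ x)⁻¹ : 𝔸ˣ) : 𝔸)‖ ≤ 1)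
include hU

/-- ★★★ **THE FIRST-ORDER WORDS**: `‖(V¹_μY)(b)‖ ≤ |c_f|·(4ω₁ + 8(d+1)(ω₃ + 2ω₁))·s` for `b = ⟨x, κ⟩`, the bond window `ω₁` and the plaquette window `ω₃` holding in the
blocks within distance `2` of the block of `x`, and `‖Y‖ ≤ s` there. [cite: Balaban1985BackgroundPropagators, (3.73) p.405 (the `O(1)|A|·|∇_UA′|` term), (3.71) p.404] -/
theorem norm_V1Y_apply_le (μ : Fin (d + 1)) (b : FBondY i) {ω₁ ω₃ s : ℝ} (hs : 0 ≤ s) (hω₁ : 0 ≤ ω₁) (hω₃ : 0 ≤ ω₃)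
    (hW1 : ∀ (a : Fin (d + 1)) (y : Site (PV d ℓ i.m i.K hd hL) 0), dSite i q (blkCubeY i q (chartY i b.src)) y ≤ 2 → ‖(V a y : 𝔸) - 1‖ ≤ ω₁)
    (hW3 : ∀ p : PlaqY i, dSite i q (blkCubeY i q (chartY i b.src)) p.src ≤ 2 → ‖reHolY i V p - 1‖ ≤ ω₃)
    (Y : FBondY i → 𝔸) (hY : ∀ e : FBondY i, dSite i q (blkCubeY i q (chartY i b.src)) e.src ≤ 2 → ‖Y e‖ ≤ s) :
    ‖V1Y i V μ Y b‖ ≤ |i.cf| * ((4 * ω₁ + 8 * ((d : ℝ) + 1) * (ω₃ + 2 * ω₁)) * s) := by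
  have h0 := dSite_self i q b.src
  have hx1 : ∀ a : Fin (d + 1), dSite i q (blkCubeY i q (chartY i b.src)) (b.src.unshift a) ≤ 2 := fun a => by
    linarith [(dSite_shift_le i q (blkCubeY i q (chartY i b.src)) b.src a).2]
  rw [V1Y, LinearMap.sub_apply, Pi.sub_apply, LinearMap.comp_apply]
  refine (norm_sub_le _ _).trans ?_
  have t1 := norm_WY_apply_le i hU μ b hs (fun a => hW1 a _ (hx1 μ)) Y
    ⟨hY b (by rw [h0]; norm_num), hY _ (by
      show dSite i q _ ((b.src.shift b.dir).unshift μ) ≤ 2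
      linarith [(dSite_shift_le i q (blkCubeY i q (chartY i b.src)) b.src b.dir).1,
        (dSite_shift_le i q (blkCubeY i q (chartY i b.src)) (b.src.shift b.dir) μ).2, h0])⟩
  have t2 := norm_coCurlJordan_sub_apply_le i hU b (s := 2 * s) (by positivity) hω₁ hω₃
    (fun p m h a => hW1 a p.src ((dSite_plaq_src_le i q h).trans (by norm_num)))
    (fun p m h => hW3 p ((dSite_plaq_src_le i q h).trans (by norm_num))) (selY i μ Y)
    (fun p m h => norm_selY_apply_le i μ p Y ⟨hY _ (dSite_edge_src_le i q h 1), hY _ (dSite_edge_src_le i q h 2)⟩)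
  have e : |i.cf| * ((4 * ω₁ + 8 * ((d : ℝ) + 1) * (ω₃ + 2 * ω₁)) * s) =
      |i.cf| * (4 * ω₁ * s) + |i.cf| * (4 * ((d : ℝ) + 1) * ((ω₃ + 2 * ω₁) * (2 * s))) := by ring
  rw [e]
  exact add_le_add t1 t2

/-- ★★★ **THE ZEROTH-ORDER PART**: `‖(V⁰X)(b)‖ ≤ c_f²·(d+1)·(4ω₂ + 16(ω₃ + 2ω₁)ω₁ + 16ω₃)·s` for `b = ⟨x, κ⟩`, the bond window `ω₁`, the VARIATION window `ω₂` at `x`, the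
plaquette windows `ω₃` (`Re U(∂p) − 1` and `Im U(∂p)`) in the blocks within distance `2` of the block of `x`, and `‖X‖ ≤ s` there.
[cite: Balaban1985BackgroundPropagators, (3.73) p.405 (the `O(1)(|∇A| + |A|²)·|A′|` term and (3.69)), (3.71) p.404] -/
theorem norm_V0Y_apply_le (b : FBondY i) {ω₁ ω₂ ω₃ s : ℝ} (hs : 0 ≤ s) (hω₁ : 0 ≤ ω₁) (hω₃ : 0 ≤ ω₃)
    (hW1 : ∀ (a : Fin (d + 1)) (y : Site (PV d ℓ i.m i.K hd hL) 0), dSite i q (blkCubeY i q (chartY i b.src)) y ≤ 2 → ‖(V a y : 𝔸) - 1‖ ≤ ω₁)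
    (hW2 : ∀ a μ : Fin (d + 1), ‖(V a b.src : 𝔸) - V a (b.src.unshift μ)‖ ≤ ω₂)
    (hW3 : ∀ p : PlaqY i, dSite i q (blkCubeY i q (chartY i b.src)) p.src ≤ 2 → ‖reHolY i V p - 1‖ ≤ ω₃ ∧ ‖imHolY i V p‖ ≤ ω₃)
    (X : FBondY i → 𝔸) (hX : ∀ e : FBondY i, dSite i q (blkCubeY i q (chartY i b.src)) e.src ≤ 2 → ‖X e‖ ≤ s) :
    ‖V0Y i V X b‖ ≤ i.cf ^ 2 * (((d : ℝ) + 1) * ((4 * ω₂ + 16 * ((ω₃ + 2 * ω₁) * ω₁) + 16 * ω₃) * s)) := by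
  have h0 := dSite_self i q b.src
  have hx0 : ∀ a : Fin (d + 1), dSite i q (blkCubeY i q (chartY i b.src)) (b.src.shift a) ≤ 2 := fun a => by
    linarith [(dSite_shift_le i q (blkCubeY i q (chartY i b.src)) b.src a).1]
  rw [V0Y, LinearMap.sub_apply, LinearMap.sub_apply, Pi.sub_apply, Pi.sub_apply, LinearMap.smul_apply, Pi.smul_apply, LinearMap.comp_apply]
  have n1 := norm_sub_le (B10Y i V X b - ((i.cf : ℝ) : ℂ) •
    ((coCurlY i V ∘ₗ jordanY i V - coCurlY i (fun _ _ => (1 : 𝔸ˣ))) : (PlaqY i → 𝔸) →ₗ[ℂ] (FBondY i → 𝔸)) (KY i V X) b) (curv2Y i V X b)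
  have n2 := norm_sub_le (B10Y i V X b) (((i.cf : ℝ) : ℂ) •
    ((coCurlY i V ∘ₗ jordanY i V - coCurlY i (fun _ _ => (1 : 𝔸ˣ))) : (PlaqY i → 𝔸) →ₗ[ℂ] (FBondY i → 𝔸)) (KY i V X) b)
  have t1 := norm_B10Y_apply_le i hU b hs hW2 X (fun μ => ⟨hX _ (hx0 μ), hX _ (hx0 b.dir)⟩)
  have t3 := norm_curv2Y_apply_le i hU b hs hω₃ (fun p m h => (hW3 p ((dSite_plaq_src_le i q h).trans (by norm_num))).2) X
    (fun p m h l => hX _ (dSite_edge_src_le i q h l))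
  have t2' := norm_coCurlJordan_sub_apply_le i hU b (s := 4 * ω₁ * s) (by positivity) hω₁ hω₃
    (fun p m h a => hW1 a p.src ((dSite_plaq_src_le i q h).trans (by norm_num)))
    (fun p m h => (hW3 p ((dSite_plaq_src_le i q h).trans (by norm_num))).1) (KY i V X)
    (fun p m h => norm_KY_apply_le i hU p hs (fun a => hW1 a p.src ((dSite_plaq_src_le i q h).trans (by norm_num))) X
      ⟨hX _ (dSite_edge_src_le i q h 3), hX _ (dSite_edge_src_le i q h 0)⟩)
  have t2 : ‖((i.cf : ℝ) : ℂ) • ((coCurlY i V ∘ₗ jordanY i V - coCurlY i (fun _ _ => (1 : 𝔸ˣ))) : (PlaqY i → 𝔸) →ₗ[ℂ] (FBondY i → 𝔸)) (KY i V X) b‖ ≤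
      |i.cf| * (|i.cf| * (4 * ((d : ℝ) + 1) * ((ω₃ + 2 * ω₁) * (4 * ω₁ * s)))) := by
    rw [norm_smul, Complex.norm_real, Real.norm_eq_abs]
    exact mul_le_mul_of_nonneg_left t2' (abs_nonneg _)
  have e : i.cf ^ 2 * (((d : ℝ) + 1) * ((4 * ω₂ + 16 * ((ω₃ + 2 * ω₁) * ω₁) + 16 * ω₃) * s)) =
      i.cf ^ 2 * (((d : ℝ) + 1) * (4 * ω₂ * s)) + |i.cf| * (|i.cf| * (4 * ((d : ℝ) + 1) * ((ω₃ + 2 * ω₁) * (4 * ω₁ * s)))) +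
        i.cf ^ 2 * (16 * ((d : ℝ) + 1) * (ω₃ * s)) := by
    rw [← sq_abs i.cf]; ring
  rw [e]
  linarith [n1, n2, t1, t2, t3]

end Assembly


/-! ## §6  ★★★ REALIFIED: the `hV0`, `hV1 ν` inputs of `B9Cor35GAtCubeLetters.cor35_G_cube_of_pieces` from the three block-neighbourhood windows -/

section Majorant

variable (q : ↥(cubes (toKT i).D.toDomains))

/-- the block of a fine bond in r05's cube family is the block of its source site. [cite: Balaban1984PropagatorsII, (2.16) p.225, dictionary] -/
theorem blkV1_cubeFamY_eq (f : FBondY i) : blkV1 i.hN (cubeFamY i q) f = blkCubeY i q (chartY i f.src) := rfl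

/-- `|c_f| = η⁻¹`. [cite: Balaban1985BackgroundPropagators, (3.26) p.395, dictionary] -/
theorem abs_cf_eq : |i.cf| = ((kGeo i).eta)⁻¹ := by rw [kGeo_eta, inv_inv]

/-- the `(3.73)`-constants of the two pieces (absolute constants depending on `d` only, p. 405). [cite: Balaban1985BackgroundPropagators, (3.73) p.405] -/
def cV1 (d : ℕ) : ℝ := 4 + 24 * ((d : ℝ) + 1)

/-- the `(3.73)`-constant of the zeroth-order part (absolute, depending on `d` only, p. 405). [cite: Balaban1985BackgroundPropagators, (3.73) p.405] -/
def cV0 (d : ℕ) : ℝ := 68 * ((d : ℝ) + 1)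

variable {ιb : Type} [Fintype ιb] (b : Module.Basis ιb ℝ 𝔸)
variable {V : CfgY 𝔸 i} (hU : ∀ μ x, ‖(V μ x : 𝔸)‖ ≤ 1 ∧ ‖(((V μ x)⁻¹ : 𝔸ˣ) : 𝔸)‖ ≤ 1)
include hU

/-- ★★★ **`hV1 ν` OF `cor35_G_cube_of_pieces`**: under the BOND window `‖V − 1‖ ≤ α₁η∕len(a)` and the PLAQUETTE window `‖Re U(∂p) − 1‖ ≤ α₁(η∕len(a))²` holding at every
site∕plaquette whose block is within graph distance `2` of the block `a` («the norms determined by the set st(b)», p. 405), the realified first-order word has the majorant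
`conj b(V¹_ν) ≺ (M₂Σ‖b_j‖)·c_{V1}(d)·e^{2δ}·α₁·len(a)⁻¹·e^{−δd(a,a′)}` over `toB6 (geoCK i □) Rr H`. [cite: Balaban1985BackgroundPropagators, (3.73) p.405, (3.85) p.407; Balaban1984PropagatorsII, (2.51) p.232] -/
theorem hasMajorant_V1Y {M₂ : ℝ} (hM₂ : 0 ≤ M₂) (hrepr : ∀ (v : 𝔸) (j : ιb), |b.repr v j| ≤ M₂ * ‖v‖) {α₁ : ℝ} (hα₁ : 0 ≤ α₁)
    (hW1 : ∀ (a : BlkCubeY i q) (a' : Fin (d + 1)) (y : Site (PV d ℓ i.m i.K hd hL) 0), dSite i q a y ≤ 2 →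
      ‖(V a' y : 𝔸) - 1‖ ≤ α₁ * ((kGeo i).eta * ((geoCK i q).len a)⁻¹))
    (hW3 : ∀ (a : BlkCubeY i q) (p : PlaqY i), dSite i q a p.src ≤ 2 → ‖reHolY i V p - 1‖ ≤ α₁ * ((kGeo i).eta * ((geoCK i q).len a)⁻¹) ^ 2)
    {δ : ℝ} (hδ : 0 ≤ δ) (Rr : ℝ) (H : Prop) (ν : Fin (d + 1)) :
    HasMajorant (g := toB6 (geoCK i q) Rr H) (blkBK i q) (B9Eq352DivFormLetters.conj b ((V1Y i V ν).restrictScalars ℝ))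
      (fun a a' => (M₂ * ∑ j, ‖b j‖) * (cV1 d * Real.exp (2 * δ) * α₁ * ((geoCK i q).len a)⁻¹ * Real.exp (-(δ * (geoCK i q).dist a a')))) := by
  refine B9SectBGpReadingsY.hasMajorant_conj_of_liftY_bound b (g := toB6 (geoCK i q) Rr H) (fun f : FBondY i => blkV1 i.hN (cubeFamY i q) f) _ _
    M₂ hM₂ hrepr fun f E y' B hE hB hoff hbd bb => ?_
  rw [LinearMap.restrictScalars_apply]
  set a := blkV1 i.hN (cubeFamY i q) bb with ha
  have ha' : a = blkCubeY i q (chartY i bb.src) := rfl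
  have hη : 0 < (kGeo i).eta := by rw [← geoCK_eta i q]; exact geoCK_eta_pos i q
  have hlen : 0 < (geoCK i q).len a := geoCK_len_pos i q a
  have hηl : (kGeo i).eta * ((geoCK i q).len a)⁻¹ ≤ 1 := by
    rw [← div_eq_mul_inv, div_le_one hlen, ← geoCK_eta i q]; exact B9CubeGeometryInputs.geoCK_eta_le_len i q a
  have hηl0 : 0 ≤ (kGeo i).eta * ((geoCK i q).len a)⁻¹ := by positivity
  set ω₁ := α₁ * ((kGeo i).eta * ((geoCK i q).len a)⁻¹) with hω₁
  set ω₃ := α₁ * ((kGeo i).eta * ((geoCK i q).len a)⁻¹) ^ 2 with hω₃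
  have hω₁0 : 0 ≤ ω₁ := mul_nonneg hα₁ hηl0
  have hω₃0 : 0 ≤ ω₃ := mul_nonneg hα₁ (sq_nonneg _)
  -- the pointwise bound with s := B or s := 0 according to whether y′ is within distance 2
  have main : ∀ s : ℝ, 0 ≤ s → (∀ e : FBondY i, dSite i q a e.src ≤ 2 → ‖liftY f E e‖ ≤ s) →
      ‖V1Y i V ν (liftY f E) bb‖ ≤ cV1 d * α₁ * ((geoCK i q).len a)⁻¹ * s := by
    intro s hs hX
    have h := norm_V1Y_apply_le i q hU ν bb hs hω₁0 hω₃0 (fun a' y hy => hW1 a a' y (by rw [ha']; exact hy))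
      (fun p hp => hW3 a p (by rw [ha']; exact hp)) (liftY f E) (fun e he => hX e (by rw [ha']; exact he))
    refine h.trans ?_
    have hcf : |i.cf| ≠ 0 := by
      intro h0; rw [kGeo_eta, h0, inv_zero] at hη; exact lt_irrefl _ hη
    rw [abs_cf_eq]
    have e1 : ((kGeo i).eta)⁻¹ * ((4 * ω₁ + 8 * ((d : ℝ) + 1) * (ω₃ + 2 * ω₁)) * s) =
        α₁ * ((geoCK i q).len a)⁻¹ * ((4 + 8 * ((d : ℝ) + 1) * ((kGeo i).eta * ((geoCK i q).len a)⁻¹ + 2)) * s) := by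
      rw [hω₁, hω₃, kGeo_eta]; field_simp
    rw [e1, cV1]
    have h2 : 4 + 8 * ((d : ℝ) + 1) * ((kGeo i).eta * ((geoCK i q).len a)⁻¹ + 2) ≤ 4 + 24 * ((d : ℝ) + 1) := by nlinarith
    have h3 : 0 ≤ α₁ * ((geoCK i q).len a)⁻¹ := by positivity
    calc α₁ * ((geoCK i q).len a)⁻¹ * ((4 + 8 * ((d : ℝ) + 1) * ((kGeo i).eta * ((geoCK i q).len a)⁻¹ + 2)) * s)
        ≤ α₁ * ((geoCK i q).len a)⁻¹ * ((4 + 24 * ((d : ℝ) + 1)) * s) := by gcongr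
      _ = (4 + 24 * ((d : ℝ) + 1)) * α₁ * ((geoCK i q).len a)⁻¹ * s := by ring
  have hK0 : 0 ≤ cV1 d * α₁ * ((geoCK i q).len a)⁻¹ := by unfold cV1; positivity
  by_cases hnear : (geoCK i q).dist a y' ≤ 2
  · have h := main B hB (fun e _ => (Node00.norm_liftY_le f ⟨E, mem_closedBall_zero_iff.2 hE⟩ e).trans (hbd e))
    refine h.trans ?_
    have hexp : 1 ≤ Real.exp (2 * δ) * Real.exp (-(δ * (geoCK i q).dist a y')) := by
      rw [← Real.exp_add]; exact Real.one_le_exp (by nlinarith)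
    calc cV1 d * α₁ * ((geoCK i q).len a)⁻¹ * B = cV1 d * α₁ * ((geoCK i q).len a)⁻¹ * 1 * B := by rw [mul_one]
      _ ≤ cV1 d * α₁ * ((geoCK i q).len a)⁻¹ * (Real.exp (2 * δ) * Real.exp (-(δ * (geoCK i q).dist a y'))) * B := by gcongr
      _ = cV1 d * Real.exp (2 * δ) * α₁ * ((geoCK i q).len a)⁻¹ * Real.exp (-(δ * (geoCK i q).dist a y')) * B := by ring
  · have h := main 0 le_rfl (fun e he => by
      have hne : blkV1 i.hN (cubeFamY i q) e ≠ y' := by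
        intro heq
        apply hnear
        have : dSite i q a e.src = (geoCK i q).dist a y' := by rw [← heq]; rfl
        rw [← this]; exact he
      calc ‖liftY f E e‖ ≤ |f e| := Node00.norm_liftY_le f ⟨E, mem_closedBall_zero_iff.2 hE⟩ e
        _ = 0 := by rw [hoff e hne, abs_zero])
    rw [mul_zero] at h
    exact h.trans (mul_nonneg (by unfold cV1; positivity) hB)

/-- ★★★ **`hV0` OF `cor35_G_cube_of_pieces`**: under the BOND window, the VARIATION window `‖V_a(y) − V_a(y − e_μ)‖ ≤ α₁(η∕len(a))²` and the PLAQUETTE windows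
`‖Re U(∂p) − 1‖, ‖Im U(∂p)‖ ≤ α₁(η∕len(a))²` in the distance-2 block neighbourhood, and `α₁ ≤ 1`, the realified zeroth-order part has the majorant
`conj b(V⁰) ≺ (M₂Σ‖b_j‖)·c_{V0}(d)·e^{2δ}·α₁·(len(a)²)⁻¹·e^{−δd(a,a′)}` over `toB6 (geoCK i □) Rr H`. [cite: Balaban1985BackgroundPropagators, (3.73) p.405, (3.69) p.404, (3.85) p.407; Balaban1984PropagatorsII, (2.51) p.232] -/
theorem hasMajorant_V0Y {M₂ : ℝ} (hM₂ : 0 ≤ M₂) (hrepr : ∀ (v : 𝔸) (j : ιb), |b.repr v j| ≤ M₂ * ‖v‖) {α₁ : ℝ} (hα₁ : 0 ≤ α₁) (hα₁1 : α₁ ≤ 1)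
    (hW1 : ∀ (a : BlkCubeY i q) (a' : Fin (d + 1)) (y : Site (PV d ℓ i.m i.K hd hL) 0), dSite i q a y ≤ 2 →
      ‖(V a' y : 𝔸) - 1‖ ≤ α₁ * ((kGeo i).eta * ((geoCK i q).len a)⁻¹))
    (hW2 : ∀ (a : BlkCubeY i q) (a' μ : Fin (d + 1)) (y : Site (PV d ℓ i.m i.K hd hL) 0), dSite i q a y ≤ 2 →
      ‖(V a' y : 𝔸) - V a' (y.unshift μ)‖ ≤ α₁ * ((kGeo i).eta * ((geoCK i q).len a)⁻¹) ^ 2)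
    (hW3 : ∀ (a : BlkCubeY i q) (p : PlaqY i), dSite i q a p.src ≤ 2 →
      ‖reHolY i V p - 1‖ ≤ α₁ * ((kGeo i).eta * ((geoCK i q).len a)⁻¹) ^ 2 ∧ ‖imHolY i V p‖ ≤ α₁ * ((kGeo i).eta * ((geoCK i q).len a)⁻¹) ^ 2)
    {δ : ℝ} (hδ : 0 ≤ δ) (Rr : ℝ) (H : Prop) :
    HasMajorant (g := toB6 (geoCK i q) Rr H) (blkBK i q) (B9Eq352DivFormLetters.conj b ((V0Y i V).restrictScalars ℝ))
      (fun a a' => (M₂ * ∑ j, ‖b j‖) * (cV0 d * Real.exp (2 * δ) * α₁ * ((geoCK i q).len a ^ 2)⁻¹ * Real.exp (-(δ * (geoCK i q).dist a a')))) := by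
  refine B9SectBGpReadingsY.hasMajorant_conj_of_liftY_bound b (g := toB6 (geoCK i q) Rr H) (fun f : FBondY i => blkV1 i.hN (cubeFamY i q) f) _ _
    M₂ hM₂ hrepr fun f E y' B hE hB hoff hbd bb => ?_
  rw [LinearMap.restrictScalars_apply]
  set a := blkV1 i.hN (cubeFamY i q) bb with ha
  have ha' : a = blkCubeY i q (chartY i bb.src) := rfl
  have hη : 0 < (kGeo i).eta := by rw [← geoCK_eta i q]; exact geoCK_eta_pos i q
  have hlen : 0 < (geoCK i q).len a := geoCK_len_pos i q a
  have hηl : (kGeo i).eta * ((geoCK i q).len a)⁻¹ ≤ 1 := by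
    rw [← div_eq_mul_inv, div_le_one hlen, ← geoCK_eta i q]; exact B9CubeGeometryInputs.geoCK_eta_le_len i q a
  have hηl0 : 0 ≤ (kGeo i).eta * ((geoCK i q).len a)⁻¹ := by positivity
  set t := (kGeo i).eta * ((geoCK i q).len a)⁻¹ with ht
  set ω₁ := α₁ * t with hω₁
  set ω₂ := α₁ * t ^ 2 with hω₂
  have hω₁0 : 0 ≤ ω₁ := mul_nonneg hα₁ hηl0
  have hω₂0 : 0 ≤ ω₂ := mul_nonneg hα₁ (sq_nonneg _)
  have main : ∀ s : ℝ, 0 ≤ s → (∀ e : FBondY i, dSite i q a e.src ≤ 2 → ‖liftY f E e‖ ≤ s) →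
      ‖V0Y i V (liftY f E) bb‖ ≤ cV0 d * α₁ * ((geoCK i q).len a ^ 2)⁻¹ * s := by
    intro s hs hX
    have h0 : dSite i q a bb.src = 0 := by rw [ha']; exact dSite_self i q bb.src
    have h := norm_V0Y_apply_le i q hU bb hs hω₁0 hω₂0 (fun a' y hy => hW1 a a' y (by rw [ha']; exact hy))
      (fun a' μ => hW2 a a' μ bb.src (by rw [h0]; norm_num))
      (fun p hp => hW3 a p (by rw [ha']; exact hp)) (liftY f E) (fun e he => hX e (by rw [ha']; exact he))
    refine h.trans ?_
    have hcf : |i.cf| ≠ 0 := by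
      intro h0'; rw [kGeo_eta, h0', inv_zero] at hη; exact lt_irrefl _ hη
    have ecf : i.cf ^ 2 = (((kGeo i).eta)⁻¹) ^ 2 := by rw [← abs_cf_eq, sq_abs]
    rw [ecf]
    have e1 : (((kGeo i).eta)⁻¹) ^ 2 * (((d : ℝ) + 1) * ((4 * ω₂ + 16 * ((ω₂ + 2 * ω₁) * ω₁) + 16 * ω₂) * s)) =
        α₁ * ((geoCK i q).len a ^ 2)⁻¹ * (((d : ℝ) + 1) * ((20 + 16 * (α₁ * (t + 2))) * s)) := by
      rw [hω₁, hω₂, ht, kGeo_eta]; field_simp; ring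
    rw [e1, cV0]
    have h2 : 20 + 16 * (α₁ * (t + 2)) ≤ 68 := by nlinarith
    have h3 : 0 ≤ α₁ * ((geoCK i q).len a ^ 2)⁻¹ := by positivity
    calc α₁ * ((geoCK i q).len a ^ 2)⁻¹ * (((d : ℝ) + 1) * ((20 + 16 * (α₁ * (t + 2))) * s))
        ≤ α₁ * ((geoCK i q).len a ^ 2)⁻¹ * (((d : ℝ) + 1) * (68 * s)) := by gcongr
      _ = 68 * ((d : ℝ) + 1) * α₁ * ((geoCK i q).len a ^ 2)⁻¹ * s := by ring
  by_cases hnear : (geoCK i q).dist a y' ≤ 2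
  · have h := main B hB (fun e _ => (Node00.norm_liftY_le f ⟨E, mem_closedBall_zero_iff.2 hE⟩ e).trans (hbd e))
    refine h.trans ?_
    have hexp : 1 ≤ Real.exp (2 * δ) * Real.exp (-(δ * (geoCK i q).dist a y')) := by
      rw [← Real.exp_add]; exact Real.one_le_exp (by nlinarith)
    have hK0 : 0 ≤ cV0 d * α₁ * ((geoCK i q).len a ^ 2)⁻¹ := by unfold cV0; positivity
    calc cV0 d * α₁ * ((geoCK i q).len a ^ 2)⁻¹ * B = cV0 d * α₁ * ((geoCK i q).len a ^ 2)⁻¹ * 1 * B := by rw [mul_one]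
      _ ≤ cV0 d * α₁ * ((geoCK i q).len a ^ 2)⁻¹ * (Real.exp (2 * δ) * Real.exp (-(δ * (geoCK i q).dist a y'))) * B := by gcongr
      _ = cV0 d * Real.exp (2 * δ) * α₁ * ((geoCK i q).len a ^ 2)⁻¹ * Real.exp (-(δ * (geoCK i q).dist a y')) * B := by ring
  · have h := main 0 le_rfl (fun e he => by
      have hne : blkV1 i.hN (cubeFamY i q) e ≠ y' := by
        intro heq
        apply hnear
        have : dSite i q a e.src = (geoCK i q).dist a y' := by rw [← heq]; rfl
        rw [← this]; exact he
      calc ‖liftY f E e‖ ≤ |f e| := Node00.norm_liftY_le f ⟨E, mem_closedBall_zero_iff.2 hE⟩ e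
        _ = 0 := by rw [hoff e hne, abs_zero])
    rw [mul_zero] at h
    exact h.trans (mul_nonneg (by unfold cV0; positivity) hB)

end Majorant

end Literature.MathematicalPhysics.QuantumFieldTheory.Balaban1983to89.B9Ineq373HessianPieceBoundsY

end
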